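import Literature.MathematicalPhysics.QuantumFieldTheory.Balaban1983to89.T4DatumAssemblyTowerOfRecord
import Literature.MathematicalPhysics.QuantumFieldTheory.Balaban1983to89.Node00.ROperationOfRecordForm

/-!
# The DATUM ASSEMBLER, TOWER FORM — AT THE REPRESENTED TOWER OF RECORD, SUPPORT FORM: the adapter `towerOfRecord9` with def-R's provisos of
# [IV] p. 176 read ON THE SUPPORT (`RepData.ProvisosSupp`: «where a denominator fibre integral vanishes, the numerator piece vanishes») instead of
# the nowhere-vanishing form (`RepData.Provisos`) — the reading a stage-₉ record should certify (pub-ymgap (R-C2) MASS∕SUPPORT rider, chair R446 (A))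

YM-PLAN Track A, node **N23** lineage (seat `pub-ymgap-dag-n23-a`), sibling of `T4DatumAssemblyTowerOfRecord` (p419406) — nothing there is edited.
WHY A SIBLING (node00-def-R's located ask, pub-ymgap INBOX 2026-08-26 «RENAME-ASK RSTEP→SUPP», accepted): the 4th conjunct of `RepData.Provisos`
(«every denominator fibre integral `∫dV′⌈_{Z′}ρ(Z″,·)` is nonzero at EVERY base point») is REFUTED in the model for genuine χ-weighted (2.18)-pieces
(dag-n12-a's `not_forall_fibreIntegral_indicatorOuter_ne_zero`), so the std-form bundle `TowerProvisos` of the adapter is expected UNINHABITED for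
Bałaban's data BY TYPING and every record certifying it would be empty; the SUPPORT form loses nothing (`RepData.provisosSupp_of_provisos`: std ⇒ supp)
and is served by def-R's `Node00/ROperationOfRecordForm` (the (0.4) identity `integral_densityOfSlice_rstepSlotOfRecord_of_provisosSupp` and the
integrability `integrable_densityOfSlice_rstepSlotOfRecord_of_provisosSupp`, from dag-n10-b's support-form fibre lemma `B15FibreLemmaSupp`).

WHAT THIS FILE IS — the SUPPORT-FORM TWINS of the adapter's §1–§4, same shapes, suffix `Supp`: §1 `TowerProvisosSupp` ∕ `GenTowerProvisosSupp`
(field `rstep` over `ProvisosSupp`, INSTANCE-GENERIC in `DecidableEq (PBond (F.P p.K) (k+1))` — binder in the field, TS-8 F1, the consumer's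
instance), `TowerProvisos.supp` ∕ `GenTowerProvisos.supp` (std ⇒ supp), and the (0.4) face under the support form `integral_rhoOfRecord9_succ_supp`;
§2 `towerOfRecord9Supp` (= `towerOfRecord9` on std provisos, `rfl`), read-backs, (2.18), INTEGRABILITY of every `ρ_k` (`k ≤ K`) and `𝐓ρ_k` (`k < K`)
from the support-form provisos; §3 the datum `datumOfTowerOfRecord9Supp` (B1 = node N23, rfl read-backs, apex), the generated-history form and
«one history»; §4 `IsIntegrable`, the SHADOW operation's two obligations (the proof fields NODE 00's `Record9` shadow residual needs), the shadow
machine and the Stage-5-family shadow datum with the same construction ∕ densities.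

## HONEST FRAMING — what this is NOT

* NOT a datum of record, NOT stage ₉, NOT `Record9`: FUNCTIONS of NODE 00's plugs (core `M`, numerics `ν`, `τ`, selector `ppSel`, weights `w`,
  histories `gOf`, and the DISPLAYED support-form provisos `h`).  Nothing analytic of Bałaban's is proved or asserted; the faces are def-T's ∕ def-R's
  theorems FROM DISPLAYED HYPOTHESES; no node count moves.  One finite four-torus programme at fixed `ε` — NOT the continuum limit on ℝ⁴, NOT
  infinite volume, NOT OS, NOT a mass gap, NOT the Clay problem.
* No quotation locus is new (cell GAPS C-t4l-1): [Balaban1988Convergent] (2.18) p. 257, (3.25) p. 270, Thm 1 p. 262; [Balaban1989LargeFieldI]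
  (0.2)–(0.4) p. 176 («the integration domains … are nonempty, hence the denominators are positive» — read on the support); [Balaban1987RG1] (0.4)
  p. 253, (0.17)–(0.20) pp. 255–256; [Balaban1989LargeFieldII] Thm 1 + (0.1) pp. 355–356.
-/

noncomputable section

open MeasureTheory

namespace Literature.MathematicalPhysics.QuantumFieldTheory.Balaban1983to89

namespace T4DatumAssembly

open Missing T4Continuum T4FiniteEpsInhabited FlowStepRuns DagBinding Node00

/-! ## 1. The (0.4) face and the displayed provisos of a stage-₉ tower, SUPPORT FORM -/

section AdapterSupp

variable (F : T4Family) (N : ℕ) [NeZero N] (ν : Stage7Numerics) (τ : TowerNumerics)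
  (M : RGMachineCore F (Matrix.specialUnitaryGroup (Fin N) ℂ))
  (w : StepWeightsOfRecord F N ν τ.M) (ppSel : PpSelOfRecord F ν τ.M)
  (gOf : B12.RunParams → ℕ → ℝ)

/-- **`integral_step` UNDER THE SUPPORT-FORM PROVISOS** (the twin of def-T's `integral_rhoOfRecord9_succ`): `∫ ρ_{k+1} = ∫ 𝐓ρ_k` from def-R's
`integral_densityOfSlice_rstepSlotOfRecord_of_provisosSupp` (dag-n10-b's support-form fibre lemma); instance-generic (the consumer's `DecidableEq (PBond …)`).
[cite: Balaban1989LargeFieldI, (0.4) p.176] -/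
theorem integral_rhoOfRecord9_succ_supp (E : B12.RunParams → ℝ) (w : StepWeightsOfRecord F N ν τ.M) (ppSel : PpSelOfRecord F ν τ.M)
    (p : B12.RunParams) (g : ℕ → ℝ) (k : ℕ) [DecidableEq (PBond (F.P p.K) (k + 1))]
    (hprov : (towerRepOfRecord F N ν τ (slotsTOfRecord F N ν τ E w ppSel) ppSel p g (k + 1)).toRepData.ProvisosSupp) :
    ∫ V, rhoOfRecord9 F N ν τ E w ppSel p g (k + 1) V ∂(fieldMeasure (F.P p.K) (k + 1) (Matrix.specialUnitaryGroup (Fin N) ℂ))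
      = ∫ V, trhoOfRecord9 F N ν τ E w ppSel p g k V ∂(fieldMeasure (F.P p.K) (k + 1) (Matrix.specialUnitaryGroup (Fin N) ℂ)) := by
  rw [rhoOfRecord9_succ]
  exact integral_densityOfSlice_rstepSlotOfRecord_of_provisosSupp F N ν τ _ ppSel p g (k + 1) hprov

/-- **THE DISPLAYED PROVISOS of a stage-₉ tower, SUPPORT FORM** of the core `M` (whose `E` normalises `ρ₀`), def-R's numerics `ν`, `τ`, selector `ppSel`, step
weights `w`, along the histories `gOf p`: the history starts at the run's bare coupling; def-T's step provisos for every `k < K`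
(integrable level-`k` pieces, jointly measurable weights with `|w| ≤ 1`, measurable `χ_{k+1}`, the unity law `IsStepUnity`); def-R's
`RepData.ProvisosSupp` of the pre-𝐑 tower of record at every level `k+1 ≤ K` (the provisos of [IV] p. 176 READ ON THE SUPPORT, under which (0.4) holds — dag-n10-b's `B15FibreLemmaSupp`), instance-generic in `DecidableEq (PBond (F.P p.K) (k+1))` (binder in the field: the consumer's instance).  HYPOTHESES
of the datum — never fields of an object. [cite: Balaban1988Convergent, (3.1) p.264, (3.25) p.270; Balaban1989LargeFieldI, (0.3)–(0.4) p.176] -/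
structure TowerProvisosSupp : Prop where
  /-- the history of the run `p` starts at its bare coupling `g₀` -/
  hg0 : ∀ p : B12.RunParams, gOf p 0 = p.g0
  /-- def-T's step provisos at every step `k < K` -/
  tstep : ∀ (p : B12.RunParams) (k : ℕ), k < p.K → TStepProvisos F N ν τ M.E w ppSel p (gOf p) k
  /-- def-R's SUPPORT-FORM provisos of the pre-𝐑 tower of record at every level `k+1 ≤ K`, at every instance -/
  rstep : ∀ (p : B12.RunParams) (k : ℕ) [DecidableEq (PBond (F.P p.K) (k + 1))], k < p.K →
    (towerRepOfRecord F N ν τ (slotsTOfRecord F N ν τ M.E w ppSel) ppSel p (gOf p) (k + 1)).toRepData.ProvisosSupp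

/-- The support-form provisos ALONG THE GENERATED HISTORIES `gOf p := genSeq M.βfun p.g0` — the couplings the construction's flow carries
(`RGMachineCore.construction_g`); `hg0` is then `genSeq_zero`, free. [cite: Balaban1987RG1, (0.17)–(0.20) pp.255–256; Balaban1989LargeFieldI, (0.3)–(0.4) p.176] -/
structure GenTowerProvisosSupp : Prop where
  /-- def-T's step provisos at every step `k < K`, along the generated history -/
  tstep : ∀ (p : B12.RunParams) (k : ℕ), k < p.K → TStepProvisos F N ν τ M.E w ppSel p (genSeq M.βfun p.g0) k
  /-- def-R's SUPPORT-FORM provisos at every level `k+1 ≤ K`, along the generated history, at every instance -/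
  rstep : ∀ (p : B12.RunParams) (k : ℕ) [DecidableEq (PBond (F.P p.K) (k + 1))], k < p.K →
    (towerRepOfRecord F N ν τ (slotsTOfRecord F N ν τ M.E w ppSel) ppSel p (genSeq M.βfun p.g0) (k + 1)).toRepData.ProvisosSupp

variable {F N ν τ M w ppSel gOf}

/-- Provisos along the generated histories are provisos along `gOf p := genSeq M.βfun p.g0`. [cite: Balaban1987RG1, (0.17) p.255 (bookkeeping)] -/
theorem GenTowerProvisosSupp.towerProvisosSupp (h : GenTowerProvisosSupp F N ν τ M w ppSel) :
    TowerProvisosSupp F N ν τ M w ppSel (fun p => genSeq M.βfun p.g0) :=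
  ⟨fun p => genSeq_zero M.βfun p.g0, h.tstep, h.rstep⟩

/-- INSTANCE TRANSPORT for «std ⇒ supp» (TS-8 hygiene: both `DecidableEq (PBond P j)` instances EXPLICIT, so no unification between instance
terms is ever attempted — `cases Subsingleton.elim`): the std-form provisos at one instance give the support-form provisos at any other
(`RepData.provisosSupp_of_provisos`). [cite: Balaban1989LargeFieldI, (0.3) p.176 (bookkeeping)] -/
theorem provisosSupp_of_provisos_inst {P : Params} {j : ℕ} {G : Type} [GaugeGroup G] [MeasurableSpace G] [HaarData G]
    (d : B15RopTotal.RepData P j G) (i₁ i₂ : DecidableEq (PBond P j)) (h : haveI := i₁; d.Provisos) : haveI := i₂; d.ProvisosSupp := by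
  cases Subsingleton.elim i₁ i₂
  exact @B15RopTotal.RepData.provisosSupp_of_provisos P j G _ _ _ d i₁ h

/-- std ⇒ supp: the adapter's std-form provisos give the support-form ones, at every instance (`provisosSupp_of_provisos_inst`).
[cite: Balaban1989LargeFieldI, (0.3) p.176 (bookkeeping)] -/
theorem TowerProvisos.supp (h : TowerProvisos F N ν τ M w ppSel gOf) : TowerProvisosSupp F N ν τ M w ppSel gOf :=
  ⟨h.hg0, h.tstep, fun p k inst hk => provisosSupp_of_provisos_inst _ _ inst (h.rstep p k hk)⟩

/-- std ⇒ supp along the generated histories. [cite: Balaban1989LargeFieldI, (0.3) p.176 (bookkeeping)] -/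
theorem GenTowerProvisos.supp (h : GenTowerProvisos F N ν τ M w ppSel) : GenTowerProvisosSupp F N ν τ M w ppSel :=
  ⟨h.tstep, fun p k inst hk => provisosSupp_of_provisos_inst _ _ inst (h.rstep p k hk)⟩

/-! ## 2. THE ADAPTER, SUPPORT FORM -/


open Classical in
/-- **THE TOWER OF RECORD AS AN `RGMachineCore.Tower`, SUPPORT FORM** (the by-name adapter): densities `ρ p k := rhoOfRecord9 … p (gOf p) k = eval rep_k`,
transforms `Trho p k := trhoOfRecord9 … p (gOf p) k = eval (Tstep rep_k)`; the Wilson-start obligation by `rhoOfRecord9_zero` and `hg0` (the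
core's `rhoZero p` IS `rhoZeroOfRecord F N p.K p.g0 (M.E p)`, `rfl`), the push-forward obligation by `isRT_trhoOfRecord9` under the step provisos,
(0.4) at the step by `integral_rhoOfRecord9_succ_supp` under def-R's SUPPORT-FORM provisos (the bundle's instance-generic `rstep`, used here at the
classical instance). [cite: Balaban1988Convergent, (2.18) p.257, (3.25) p.270, Thm 1 p.262; Balaban1989LargeFieldI, (0.4) p.176] -/
def towerOfRecord9Supp (h : TowerProvisosSupp F N ν τ M w ppSel gOf) : M.Tower (avOfRecord F N) where
  ρ := fun p k => rhoOfRecord9 F N ν τ M.E w ppSel p (gOf p) k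
  Trho := fun p k => trhoOfRecord9 F N ν τ M.E w ppSel p (gOf p) k
  rho_zero := fun p => by
    rw [rhoOfRecord9_zero, h.hg0 p]
    rfl
  isRT_Trho := fun p k hk => isRT_trhoOfRecord9 F N ν τ M.E w ppSel p (gOf p) k hk (h.tstep p k hk)
  integral_succ := fun p k hk => integral_rhoOfRecord9_succ_supp F N ν τ M.E w ppSel p (gOf p) k (h.rstep p k hk)

/-- Read-back: the tower's densities ARE def-T's `rhoOfRecord9` (`rfl`). [cite: Balaban1988Convergent, (2.18) p.257 (bookkeeping)] -/
theorem towerOfRecord9Supp_ρ (h : TowerProvisosSupp F N ν τ M w ppSel gOf) (p : B12.RunParams) (k : ℕ) :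
    (towerOfRecord9Supp h).ρ p k = rhoOfRecord9 F N ν τ M.E w ppSel p (gOf p) k := rfl

/-- Read-back: the tower's `Tρ_k` ARE def-T's `trhoOfRecord9` (`rfl`). [cite: Balaban1988Convergent, (3.25) p.270 (bookkeeping)] -/
theorem towerOfRecord9Supp_Trho (h : TowerProvisosSupp F N ν τ M w ppSel gOf) (p : B12.RunParams) (k : ℕ) :
    (towerOfRecord9Supp h).Trho p k = trhoOfRecord9 F N ν τ M.E w ppSel p (gOf p) k := rfl

/-- **On std-form provisos the support-form adapter IS the adapter** (`rfl`: same densities, same transforms; the obligations are proofs).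
[cite: Balaban1988Convergent, (2.18) p.257 (bookkeeping)] -/
theorem towerOfRecord9Supp_supp (h : TowerProvisos F N ν τ M w ppSel gOf) : towerOfRecord9Supp h.supp = towerOfRecord9 h := rfl

/-- The induced large-field operation of the tower maps `𝐓ρ_k ↦ ρ_{k+1}` of record ((0.2) `ρ_{k+1} = 𝐑𝐓ρ_k`).
[cite: Balaban1988Convergent, (0.2) p.244; Balaban1989LargeFieldI, (0.3) p.176] -/
theorem inducedR_towerOfRecord9Supp (h : TowerProvisosSupp F N ν τ M w ppSel gOf) (p : B12.RunParams) (k : ℕ) :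
    (towerOfRecord9Supp h).inducedR p k (trhoOfRecord9 F N ν τ M.E w ppSel p (gOf p) k)
      = rhoOfRecord9 F N ν τ M.E w ppSel p (gOf p) (k + 1) :=
  (towerOfRecord9Supp h).inducedR_Trho p k

/-- (2.18) holds for the tower's `ρ_k` with `rep_k` of record, by construction. [cite: Balaban1988Convergent, (2.18) p.257 (bookkeeping)] -/
theorem holds_towerOfRecord9Supp_ρ (h : TowerProvisosSupp F N ν τ M w ppSel gOf) (p : B12.RunParams) (k : ℕ) :
    (repOfRecord9 F N ν τ M.E w ppSel p (gOf p) k).Holds ((towerOfRecord9Supp h).ρ p k) :=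
  holds_repOfRecord9 F N ν τ M.E w ppSel p (gOf p) k

/-- (2.18) holds for the tower's `𝐓ρ_k` with `Tstep rep_k` of record, by construction. [cite: Balaban1988Convergent, (3.25) p.270 (bookkeeping)] -/
theorem holds_towerOfRecord9Supp_Trho (h : TowerProvisosSupp F N ν τ M w ppSel gOf) (p : B12.RunParams) (k : ℕ) :
    (repTOfRecord9 F N ν τ M.E w ppSel p (gOf p) k).Holds ((towerOfRecord9Supp h).Trho p k) :=
  holds_repTOfRecord9 F N ν τ M.E w ppSel p (gOf p) k

/-! ### Integrability of the tower FROM THE PROVISOS (the display READ #43 N-n23-T1 asked of stage ₉) -/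

/-- `ρ_k` is integrable for `k < K`: the displayed step proviso `TStepProvisos.intPiece` summed over the finitely many sequences (`densityOfRepr`
is the finite sum). [cite: Balaban1988Convergent, (2.18) p.257 (bookkeeping)] -/
theorem integrable_towerOfRecord9Supp_ρ_of_lt (h : TowerProvisosSupp F N ν τ M w ppSel gOf) (p : B12.RunParams) (k : ℕ) (hk : k < p.K) :
    Integrable ((towerOfRecord9Supp h).ρ p k) (fieldMeasure (F.P p.K) k (Matrix.specialUnitaryGroup (Fin N) ℂ)) :=
  integrable_finsetSum Finset.univ (fun s _ => (h.tstep p k hk).intPiece s)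

/-- `𝐓ρ_k` is integrable for `k < K`: def-T's `integrable_piece_trhoOfRecord9` summed. [cite: Balaban1988Convergent, (3.25) p.270 (bookkeeping)] -/
theorem integrable_towerOfRecord9Supp_Trho (h : TowerProvisosSupp F N ν τ M w ppSel gOf) (p : B12.RunParams) (k : ℕ) (hk : k < p.K) :
    Integrable ((towerOfRecord9Supp h).Trho p k) (fieldMeasure (F.P p.K) (k + 1) (Matrix.specialUnitaryGroup (Fin N) ℂ)) :=
  integrable_finsetSum Finset.univ
    (fun s' _ => integrable_piece_trhoOfRecord9 F N ν τ M.E w ppSel p (gOf p) k hk (h.tstep p k hk) s')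

/-- `ρ₀` is integrable on every run (also `K = 0`): `e^{−E(p)}` times the tree's Wilson–Boltzmann weight at `β = g₀⁻²`
(`Missing.integrable_boltzmann`). [cite: Balaban1988Convergent, Thm 1 p.262 (bookkeeping)] -/
theorem integrable_towerOfRecord9Supp_ρ_zero (h : TowerProvisosSupp F N ν τ M w ppSel gOf) (p : B12.RunParams) :
    Integrable ((towerOfRecord9Supp h).ρ p 0) (fieldMeasure (F.P p.K) 0 (Matrix.specialUnitaryGroup (Fin N) ℂ)) := by
  rw [(towerOfRecord9Supp h).rho_zero p]
  exact (Missing.integrable_boltzmann RegularGaugeGroup.measurable_reTr (F.P p.K) (sq_nonneg _)).const_mul _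

open Classical in
/-- `ρ_{k+1}` is integrable for `k < K` (so up to the TOP level `K`): it IS the (0.3)-density of the pre-𝐑 tower of record at level `k+1` (def-R's
`rop_towerRepOfRecord_eq_densityOfSlice`, def-T's `rhoOfRecord9_succ`), integrable under def-R's displayed SUPPORT-FORM provisos (`Node00.integrable_densityOfSlice_rstepSlotOfRecord_of_provisosSupp`).
[cite: Balaban1989LargeFieldI, (0.3)–(0.4) p.176] -/
theorem integrable_towerOfRecord9Supp_ρ_succ (h : TowerProvisosSupp F N ν τ M w ppSel gOf) (p : B12.RunParams) (k : ℕ) (hk : k < p.K) :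
    Integrable ((towerOfRecord9Supp h).ρ p (k + 1)) (fieldMeasure (F.P p.K) (k + 1) (Matrix.specialUnitaryGroup (Fin N) ℂ)) := by
  rw [towerOfRecord9Supp_ρ, rhoOfRecord9_succ]
  exact integrable_densityOfSlice_rstepSlotOfRecord_of_provisosSupp F N ν τ _ ppSel p (gOf p) (k + 1) (h.rstep p k hk)

/-- **THE TOWER OF RECORD IS INTEGRABLE**: every `ρ_k`, `k ≤ K`, of every run is integrable for product Haar measure — from the displayed provisos
alone (the shape `RGMachineCore.Tower.IsIntegrable` of the sibling shadow module, unfolded). [cite: Balaban1988Convergent, (0.2) p.244 (kernel property of the tower, bookkeeping)] -/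
theorem integrable_towerOfRecord9Supp_ρ (h : TowerProvisosSupp F N ν τ M w ppSel gOf) (p : B12.RunParams) :
    ∀ k, k ≤ p.K → Integrable ((towerOfRecord9Supp h).ρ p k) (fieldMeasure (F.P p.K) k (Matrix.specialUnitaryGroup (Fin N) ℂ))
  | 0, _ => integrable_towerOfRecord9Supp_ρ_zero h p
  | k + 1, hk => integrable_towerOfRecord9Supp_ρ_succ h p k (Nat.lt_of_succ_le hk)

/-! ## 3. The datum of the tower of record; B1 = node N23 at it; read-backs -/

/-- **THE STAGE-₉-SHAPED DATUM of the core `M` and the tower of record** along NODE 00's averaging of record (`datumOfTower` at the adapter): its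
construction is the core's over `eval rep_k`, its realisation carries the EXPLICIT `𝐓ρ_k` and the induced `𝐑` (no `rnDeriv`; chair R437 (1)).  A
FUNCTION of NODE 00's plugs; `Record9` instantiates it. [cite: Balaban1989LargeFieldII, Thm 1 + (0.1) pp.355–356; Balaban1988Convergent, (0.2) p.244] -/
def datumOfTowerOfRecord9Supp (h : TowerProvisosSupp F N ν τ M w ppSel gOf) : FiniteEpsData F (Matrix.specialUnitaryGroup (Fin N) ℂ) :=
  datumOfTower F N M (towerOfRecord9Supp h)

/-- It IS `datumOfTower` at the adapter (`rfl`) — every theorem of `T4DatumAssemblyTower` §3 applies by name. [cite: Balaban1987RG1, (0.4) p.253 (bookkeeping)] -/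
theorem datumOfTowerOfRecord9Supp_eq (h : TowerProvisosSupp F N ν τ M w ppSel gOf) :
    datumOfTowerOfRecord9Supp h = datumOfTower F N M (towerOfRecord9Supp h) := rfl

/-- Its densities ARE `rhoOfRecord9` at the run `(K, F.m, g₀)` (`rfl`) — pointwise statements about `D.dens` ((0.1)∕(2.50) faces) are statements
about def-T's explicit functions. [cite: Balaban1988Convergent, (2.18) p.257 (bookkeeping)] -/
theorem dens_datumOfTowerOfRecord9Supp (h : TowerProvisosSupp F N ν τ M w ppSel gOf) (K : ℕ) (g₀ : ℝ) (k : ℕ) :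
    (datumOfTowerOfRecord9Supp h).dens K g₀ k = rhoOfRecord9 F N ν τ M.E w ppSel ⟨K, F.m, g₀⟩ (gOf ⟨K, F.m, g₀⟩) k := rfl

/-- Its realised `𝐓ρ_k` ARE `trhoOfRecord9` (`rfl`). [cite: Balaban1988Convergent, (3.25) p.270 (bookkeeping)] -/
theorem trho_datumOfTowerOfRecord9Supp (h : TowerProvisosSupp F N ν τ M w ppSel gOf) (K : ℕ) (g₀ : ℝ) (k : ℕ) :
    (datumOfTowerOfRecord9Supp h).real.Trho K g₀ k = trhoOfRecord9 F N ν τ M.E w ppSel ⟨K, F.m, g₀⟩ (gOf ⟨K, F.m, g₀⟩) k := rfl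

/-- Its construction is the core's over the densities of record (`rfl`) — the term a stage-₉ binding world sets as its `C`.
[cite: Balaban1989LargeFieldII, Thm 1 + (0.1) pp.355–356 (bookkeeping)] -/
theorem datumOfTowerOfRecord9Supp_C (h : TowerProvisosSupp F N ν τ M w ppSel gOf) :
    (datumOfTowerOfRecord9Supp h).C = M.construction (towerOfRecord9Supp h).ρ := rfl

/-- Its β-functions are the core's (`rfl`). [cite: Balaban1987RG1, (1.22) p.264 (bookkeeping)] -/
theorem datumOfTowerOfRecord9Supp_βfun (h : TowerProvisosSupp F N ν τ M w ppSel gOf) : (datumOfTowerOfRecord9Supp h).βfun = M.βfun := rfl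

/-- Its averaging maps are NODE 00's averaging operations of record (`rfl`). [cite: Balaban1987RG1, (0.4) p.253 (bookkeeping)] -/
theorem datumOfTowerOfRecord9Supp_av (h : TowerProvisosSupp F N ν τ M w ppSel gOf) : (datumOfTowerOfRecord9Supp h).av = avOfRecord F N := rfl

/-- STAGE-0 DATUM CLAUSE (`rfl`). [cite: Balaban1987RG1, (0.3)–(0.4) p.253] -/
theorem isDatumOfRecord₀_datumOfTowerOfRecord9Supp (h : TowerProvisosSupp F N ν τ M w ppSel gOf) :
    IsDatumOfRecord₀ F N (datumOfTowerOfRecord9Supp h) := rfl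

/-- **BINDER B1 = NODE N23 AT THE DATUM OF THE TOWER OF RECORD**, hypothesis-free beyond the displayed provisos that BUILD the datum
(`isPrintedAveraged_datumOfTower`). [cite: Balaban1987RG1, (0.4) p.253] -/
theorem isPrintedAveraged_datumOfTowerOfRecord9Supp (h : TowerProvisosSupp F N ν τ M w ppSel gOf) : (datumOfTowerOfRecord9Supp h).IsPrintedAveraged :=
  isPrintedAveraged_datumOfTower F N M _

/-- (2.18) holds for the datum's densities with `rep_k` of record, by construction. [cite: Balaban1988Convergent, (2.18) p.257 (bookkeeping)] -/
theorem holds_dens_datumOfTowerOfRecord9Supp (h : TowerProvisosSupp F N ν τ M w ppSel gOf) (K : ℕ) (g₀ : ℝ) (k : ℕ) :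
    (repOfRecord9 F N ν τ M.E w ppSel ⟨K, F.m, g₀⟩ (gOf ⟨K, F.m, g₀⟩) k).Holds ((datumOfTowerOfRecord9Supp h).dens K g₀ k) :=
  holds_repOfRecord9 F N ν τ M.E w ppSel _ _ k

/-- Every density of the datum, `k ≤ K`, is integrable (`integrable_towerOfRecord9Supp_ρ` read at the datum). [cite: Balaban1988Convergent, (0.2) p.244 (bookkeeping)] -/
theorem integrable_dens_datumOfTowerOfRecord9Supp (h : TowerProvisosSupp F N ν τ M w ppSel gOf) (K : ℕ) (g₀ : ℝ) (k : ℕ) (hk : k ≤ K) :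
    Integrable ((datumOfTowerOfRecord9Supp h).dens K g₀ k) (fieldMeasure (F.P K) k (Matrix.specialUnitaryGroup (Fin N) ℂ)) :=
  integrable_towerOfRecord9Supp_ρ h ⟨K, F.m, g₀⟩ k hk

/-- **THE T⁴ APEX AT THE DATUM OF THE TOWER OF RECORD**, B1 eliminated (`continuumYM4Torus_datumOfTower`). [cite: JaffeWittenClay2006, §6.5 p.11] -/
theorem continuumYM4Torus_datumOfTowerOfRecord9Supp (h : TowerProvisosSupp F N ν τ M w ppSel gOf)
    (hB : B16.EndStatementBPrinted (datumOfTowerOfRecord9Supp h).C)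
    (hE : EndpointExistence (datumOfTowerOfRecord9Supp h).C.toB12)
    (hNE : T4ApexHybrid.HybridNE7Under (datumOfTowerOfRecord9Supp h) (EndpointExistence (datumOfTowerOfRecord9Supp h).C.toB12)) :
    T4ContinuumYM4Torus.ContinuumYM4Torus (datumOfTowerOfRecord9Supp h) :=
  continuumYM4Torus_datumOfTower F N M _ hB hE hNE

/-! ### Along the generated histories: THE SAME `g` feeds `χ_k` and the run's flow -/

/-- The tower of record along the GENERATED histories `genSeq M.βfun p.g0`. [cite: Balaban1987RG1, (0.17)–(0.20) pp.255–256; Balaban1988Convergent, (2.18) p.257] -/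
def towerOfRecord9GenSupp (h : GenTowerProvisosSupp F N ν τ M w ppSel) : M.Tower (avOfRecord F N) :=
  towerOfRecord9Supp h.towerProvisosSupp

/-- It IS the adapter at `gOf p := genSeq M.βfun p.g0` (`rfl`). [cite: Balaban1987RG1, (0.17) p.255 (bookkeeping)] -/
theorem towerOfRecord9GenSupp_eq (h : GenTowerProvisosSupp F N ν τ M w ppSel) : towerOfRecord9GenSupp h = towerOfRecord9Supp h.towerProvisosSupp := rfl

/-- **ONE HISTORY**: at the datum of the tower of record along the generated histories, the couplings of the run `p` carried by its flow ARE
`genSeq M.βfun p.g0` — the history its densities' characteristic functions `χ_k(s)` and slots are indexed by (both `rfl`; def-T's plug (5),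
«`Record9` must feed the SAME `g` to `chiSeqOfRecord` and to `(w.C p).flow`»). [cite: Balaban1987RG1, (0.17)–(0.20) pp.255–256; Balaban1988Convergent, (2.17)–(2.18) p.257] -/
theorem flow_g_and_dens_towerOfRecord9GenSupp (h : GenTowerProvisosSupp F N ν τ M w ppSel) (p : B12.RunParams) :
    ((datumOfTower F N M (towerOfRecord9GenSupp h)).C p).flow.g = genSeq M.βfun p.g0 ∧
      ∀ k, (datumOfTower F N M (towerOfRecord9GenSupp h)).dens p.K p.g0 k
        = rhoOfRecord9 F N ν τ M.E w ppSel ⟨p.K, F.m, p.g0⟩ (genSeq M.βfun p.g0) k :=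
  ⟨rfl, fun _ => rfl⟩


/-! ## 4. The tower of record is INTEGRABLE; the shadow obligations discharged at it (the proof fields of `Record9`'s shadow residual) -/

/-- **THE TOWER OF RECORD IS INTEGRABLE** (`RGMachineCore.Tower.IsIntegrable`, READ #43 N-n23-T1's display as a theorem): every `ρ_k`, `k ≤ K`, from
the displayed provisos alone. [cite: Balaban1988Convergent, (0.2) p.244 (kernel property of the tower, bookkeeping)] -/
theorem isIntegrable_towerOfRecord9Supp (h : TowerProvisosSupp F N ν τ M w ppSel gOf) : (towerOfRecord9Supp h).IsIntegrable :=
  fun p k hk => integrable_towerOfRecord9Supp_ρ h p k hk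

/-- … along the generated histories. [cite: Balaban1988Convergent, (0.2) p.244 (bookkeeping)] -/
theorem isIntegrable_towerOfRecord9GenSupp (h : GenTowerProvisosSupp F N ν τ M w ppSel) : (towerOfRecord9GenSupp h).IsIntegrable :=
  isIntegrable_towerOfRecord9Supp h.towerProvisosSupp

/-- The SHADOW large-field operation of the tower of record IS `inducedAt (rnTransport (avOfRecord K k) ρ_k) ρ_{k+1}` at def-T's explicit densities
(`rfl`) — the residual `R` a stage-₉ Stage-5-family shadow sets. [cite: Balaban1989LargeFieldI, (0.2)–(0.3) p.176; Balaban1987RG1, (0.13) p.254 (bookkeeping)] -/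
theorem shadowR_towerOfRecord9Supp (h : TowerProvisosSupp F N ν τ M w ppSel gOf) (p : B12.RunParams) (k : ℕ) :
    (towerOfRecord9Supp h).shadowR p k
      = inducedAt (AveragingRT.rnTransport (avOfRecord F N p.K k).avg (rhoOfRecord9 F N ν τ M.E w ppSel p (gOf p) k))
          (rhoOfRecord9 F N ν τ M.E w ppSel p (gOf p) (k + 1)) := rfl

/-- **(0.4) FOR THE SHADOW OPERATION OF THE TOWER OF RECORD**, every density, `k < K` — from def-T's two faces at step `k`, the measurability and Haar
bracket of the averaging of record, and the integrability of `ρ_k` from the provisos (the `preservesIntegral_R` proof field of a shadow residual).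
[cite: Balaban1989LargeFieldI, (0.4) p.176] -/
theorem preservesIntegral_shadowR_towerOfRecord9Supp (h : TowerProvisosSupp F N ν τ M w ppSel gOf) (p : B12.RunParams) (k : ℕ) (hk : k < p.K) :
    PreservesIntegral ((towerOfRecord9Supp h).shadowR p k) :=
  (towerOfRecord9Supp h).preservesIntegral_shadowR p k hk (avOfRecord_measurable F N p.K k) (avOfRecord_haarAC F N p.K k hk)
    (integrable_towerOfRecord9Supp_ρ h p k hk.le)

/-- **INTEGRABILITY PRESERVATION for the shadow operation of the tower of record**, `k < K` (the `integrable_R` proof field of a shadow residual).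
[cite: Balaban1989LargeFieldI, (0.3)–(0.4) p.176 (bookkeeping)] -/
theorem integrable_shadowR_towerOfRecord9Supp (h : TowerProvisosSupp F N ν τ M w ppSel gOf) (p : B12.RunParams) (k : ℕ) (hk : k < p.K)
    (σ : Density (F.P p.K) (k + 1) (Matrix.specialUnitaryGroup (Fin N) ℂ))
    (hσ : Integrable σ (fieldMeasure (F.P p.K) (k + 1) (Matrix.specialUnitaryGroup (Fin N) ℂ))) :
    Integrable ((towerOfRecord9Supp h).shadowR p k σ) (fieldMeasure (F.P p.K) (k + 1) (Matrix.specialUnitaryGroup (Fin N) ℂ)) :=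
  (towerOfRecord9Supp h).integrable_shadowR p k (integrable_towerOfRecord9Supp_ρ h p (k + 1) (Nat.succ_le_of_lt hk)) σ hσ

/-- **THE SHADOW MACHINE OF THE TOWER OF RECORD** (`shadowMachineOfRecord` at `isIntegrable_towerOfRecord9Supp`): an `RGMachine` of the Stage-5 family whose
core is `M` (`rfl`) and whose Radon–Nikodym recursion reproduces def-T's densities. [cite: Balaban1988Convergent, (0.2) p.244] -/
def shadowMachineOfTowerOfRecord9Supp (h : TowerProvisosSupp F N ν τ M w ppSel gOf) : RGMachine F (Matrix.specialUnitaryGroup (Fin N) ℂ) :=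
  shadowMachineOfRecord F N M (towerOfRecord9Supp h) (isIntegrable_towerOfRecord9Supp h)

/-- Its core is `M` (`rfl`). [cite: Balaban1988Convergent, (0.2) p.244 (bookkeeping)] -/
theorem shadowMachineOfTowerOfRecord9Supp_toCore (h : TowerProvisosSupp F N ν τ M w ppSel gOf) : (shadowMachineOfTowerOfRecord9Supp h).toCore = M := rfl

/-- Its large-field operation is the shadow operation of the tower of record (`rfl`). [cite: Balaban1989LargeFieldI, (0.3) p.176 (bookkeeping)] -/
theorem shadowMachineOfTowerOfRecord9Supp_R (h : TowerProvisosSupp F N ν τ M w ppSel gOf) (p : B12.RunParams) (k : ℕ) :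
    (shadowMachineOfTowerOfRecord9Supp h).R p k = (towerOfRecord9Supp h).shadowR p k := rfl

/-- **THE STAGE-5-FAMILY SHADOW DATUM has the same construction** as the datum of the tower of record. [cite: Balaban1989LargeFieldII, Thm 1 + (0.1) pp.355–356 (bookkeeping)] -/
theorem datumOfRecord_shadowSupp_C (h : TowerProvisosSupp F N ν τ M w ppSel gOf) :
    (datumOfRecord F N (shadowMachineOfTowerOfRecord9Supp h)).C = (datumOfTowerOfRecord9Supp h).C :=
  datumOfRecord_shadowMachineOfRecord_C F N M _ _

/-- … and the same densities — def-T's explicit `rhoOfRecord9`. [cite: Balaban1988Convergent, (2.18) p.257 (bookkeeping)] -/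
theorem dens_datumOfRecord_shadowSupp (h : TowerProvisosSupp F N ν τ M w ppSel gOf) (K : ℕ) (g₀ : ℝ) (k : ℕ) :
    (datumOfRecord F N (shadowMachineOfTowerOfRecord9Supp h)).dens K g₀ k = rhoOfRecord9 F N ν τ M.E w ppSel ⟨K, F.m, g₀⟩ (gOf ⟨K, F.m, g₀⟩) k :=
  dens_datumOfRecord_shadowMachineOfRecord F N M _ _ K g₀ k

end AdapterSupp

end T4DatumAssembly

end Literature.MathematicalPhysics.QuantumFieldTheory.Balaban1983to89

end
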